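import Mathlib
import HarnessLib
import Literature.Analysis.Complex.HedgehogMoments
import Literature.Analysis.SpecialFunctions.BesselKLaplaceEndpoint
import Summits.AtomisticToContinuum.Crystallization.Theorems.HolmgrenBoyleLindHalfSpaceUniqueContinuationShellLaplace
import Summits.AtomisticToContinuum.Crystallization.Theorems.HolmgrenBoyleLindHalfSpaceUniqueContinuationZeroModeLaplace

/-!
# Route `HolmgrenBoyleLind`: Lennard-Jones force fields of separated sources, part 16 —
from vanishing mode sums along an arithmetic progression of observers to vanishing fibres

Support file for the crux item stmt-AtomisticToContinuum-6075 (`HalfSpaceUniqueContinuation`, line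
`registered`, layered core, INTERFACE RIGIDITY; written by a stub-worker of lead c3). ABSTRACT
SETTING (no geometry): frequencies `k : K` with shell radii `ρ k ≥ 0` (`ρ k = 0 ↔ k = k₀`, finite
shells, `∑ₖ e^{-ε ρ k} < ∞`), unimodular `χ k` INJECTIVE in `k` (totally irrational registry) and
`ψ k`; sources `q : R` with heights `y q ≥ 0` (window count `N`) and mode weights `‖θ k q‖ ≤ 1`;
the vertical mode of frequency `k` at depth `X` is `M k X = ∑_q θ k q · 𝔪(ρ k, X + y q)` with the
explicit layer profiles `𝔪` of part 15 (written inline in the statement).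

* **`hbl_fibres_eq_zero_of_modeMoments`** (registered ∀-form; binder form `…'`) — if
  `∑ₖ ψ k (χ k)ⁿ M k (X₀ + n h) = 0` for all `n ∈ ℕ`, then every fibre `∑_{q : y q = η} θ k q`
  vanishes. Proof: these are the moments of a complex measure on a HEDGEHOG indexed by `K × Bool`
  (`Literature.Analysis.Complex.laplace_class_eq_zero_of_hedgehog_moments`): for `k ≠ k₀` the spokes
  `(k, b)` carry `besselLaplaceMeasure νᵦ pᵦ (2πρ k) (X₀/2)`, `(νᵦ, pᵦ) = (3,2), (6,5)`, with the
  regularised structure-factor densities of `hbl_hasSum_shell_eq_laplace`; the zero mode is one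
  spoke `|ρ₀| dl` on `(0, ∞)` (`ρ₀` the density of `hbl_hasSum_zeroMode_eq_laplace`) with density
  `−π ψ k₀ e^{-l X₀/2} ρ₀/|ρ₀|`; the weights are summable by the shell decay. Injectivity of `χ` makes
  the direction classes single frequencies, so each `M k` vanishes for `X > X₀`; then
  `hbl_shell_fibres_eq_zero_of_laplace_eq` (`besselLaplaceMeasure_le_mul_near_endpoint`) for
  `k ≠ k₀` and `hbl_zeroMode_fibres_eq_zero` for `k = k₀`. All `[folklore]`; closes no item.
-/

noncomputable section

namespace Summit.AtomisticToContinuum.Crystallization.Theorems.HolmgrenBoyleLind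

open scoped BigOperators Topology
open MeasureTheory Filter Set Literature.Analysis.SpecialFunctions

section Spokes

variable {R : Type*} {θ : R → ℂ} {y : R → ℝ} {N : ℕ}

/-- A BESSEL SPOKE density `S(l) = w e^{-max(l,c) A} σ(max(l,c))`, `σ(l) = ∑_q θ q e^{-l y_q}` the
structure-factor series regularised below the endpoint `c`, is measurable, bounded by
`‖w‖ ∑_q e^{-c y_q}`, and against any measure carried by `[c, ∞)` its Laplace transform at `X` is
`w ∫ e^{-l(X + A)} σ(max(l,c)) dμ`. [folklore] -/
private theorem hbl_mf_besselSpoke (hθ : ∀ q, ‖θ q‖ ≤ 1) (hy : ∀ q, 0 ≤ y q)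
    (hN : ∀ j : ℕ, {q : R | (j : ℝ) ≤ y q ∧ y q ≤ j + 1}.encard ≤ N) {c A : ℝ} (hc : 0 < c)
    (hA : 0 ≤ A) (w : ℂ) {S : ℝ → ℂ} (hS : S = fun l => w * Complex.exp (-((max l c * A : ℝ) : ℂ)) *
      ∑' q, θ q * Complex.exp (-((y q : ℂ) * ((max l c : ℝ) : ℂ)))) :
    Measurable S ∧ (∀ l, ‖S l‖ ≤ ‖w‖ * ∑' q, Real.exp (-(c * y q))) ∧
    ∀ μ : Measure ℝ, μ (Iio c) = 0 → ∀ X Z : ℝ, Z = X + A →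
      ∫ l, Complex.exp (-((l * X : ℝ) : ℂ)) * S l ∂μ = w * ∫ l, Complex.exp (-((l * Z : ℝ) : ℂ)) *
        (∑' q, θ q * Complex.exp (-((y q : ℂ) * ((max l c : ℝ) : ℂ)))) ∂μ := by
  subst hS
  obtain ⟨hσc, -⟩ := hbl_continuous_shellSeries_max hθ hy hN hc
  have hYs : Summable fun q => Real.exp (-(c * y q)) := by
    simpa only [norm_one, one_mul] using
      (hbl_shellSeries_summable (θ := fun _ : R => (1 : ℂ)) (fun _ => norm_one.le) hy hN hc).1
  refine ⟨?_, fun l => ?_, fun μ hμ X Z hZ => ?_⟩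
  · exact ((continuous_const.mul (Complex.continuous_exp.comp (Complex.continuous_ofReal.comp
      ((continuous_id.max continuous_const).mul continuous_const)).neg)).mul hσc).measurable
  · dsimp only
    rw [norm_mul, norm_mul, ← Complex.ofReal_neg, Complex.norm_exp_ofReal]
    have h1 : Real.exp (-(max l c * A)) ≤ 1 :=
      Real.exp_le_one_iff.2 (neg_nonpos.2 (mul_nonneg (hc.le.trans (le_max_right _ _)) hA))
    refine mul_le_mul (mul_le_of_le_one_right (norm_nonneg _) h1)
      (tsum_of_norm_bounded hYs.hasSum fun q => ?_) (norm_nonneg _) (norm_nonneg _)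
    rw [hbl_norm_mul_cexp_neg_mul]
    exact (mul_le_mul (hθ q) (Real.exp_le_exp.2 (neg_le_neg (mul_le_mul_of_nonneg_right
      (le_max_right l c) (hy q)))) (Real.exp_pos _).le zero_le_one).trans_eq (one_mul _)
  · rw [← integral_const_mul]
    refine integral_congr_ae ?_
    filter_upwards [measure_eq_zero_iff_ae_notMem.1 hμ] with l hl
    rw [mem_Iio, not_lt] at hl
    simp only [max_eq_left hl, hZ]
    rw [show (((l * (X + A) : ℝ)) : ℂ) = ((l * X : ℝ) : ℂ) + ((l * A : ℝ) : ℂ) by push_cast; ring,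
      neg_add, Complex.exp_add]
    ring

/-- The ZERO-MODE SPOKE: `D` the zero-mode density of part 13 (shift `t₀`) extended by `0` to
`l ≤ 0`, the measure `m = |D| dl` on `(0, ∞)` and the density `S = w e^{-max(l,0) t₀} D/|D|`: `m` is
finite and carried by `[0, ∞)`, `S` is measurable and bounded by `‖w‖`, and
`∫ e^{-lX} S dm = w ∑_q θ q ((X + 2t₀ + y_q)⁻⁵/3 − (X + 2t₀ + y_q)⁻¹¹/6)` for `X ≥ 0`. [folklore] -/
private theorem hbl_mf_zeroSpoke [Countable R] (hθ : ∀ q, ‖θ q‖ ≤ 1) (hy : ∀ q, 0 ≤ y q)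
    (hN : ∀ j : ℕ, {q : R | (j : ℝ) ≤ y q ∧ y q ≤ j + 1}.encard ≤ N) {t₀ : ℝ} (ht₀ : 0 < t₀)
    (w : ℂ) {D : ℝ → ℂ} (hD : D = (Ioi (0 : ℝ)).piecewise (fun l =>
      (∑' q, θ q * Complex.exp (-(((y q + t₀) * l : ℝ) : ℂ))) *
        (((l ^ 4 / (3 * Real.Gamma 5) - l ^ 10 / (6 * Real.Gamma 11) : ℝ)) : ℂ)) 0)
    {m : Measure ℝ} (hm : m = (volume.restrict (Ioi (0 : ℝ))).withDensity fun l => ‖D l‖ₑ)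
    {S : ℝ → ℂ} (hS : S = fun l => w * Complex.exp (-((max l 0 * t₀ : ℝ) : ℂ)) * (D l / (‖D l‖ : ℂ))) :
    IsFiniteMeasure m ∧ m (Iio 0) = 0 ∧ Measurable S ∧ (∀ l, ‖S l‖ ≤ ‖w‖) ∧
    ∀ X : ℝ, 0 ≤ X → ∫ l, Complex.exp (-((l * X : ℝ) : ℂ)) * S l ∂m = w * ∑' q, θ q *
      ((((X + t₀ + y q + t₀)⁻¹ ^ 5 / 3 - (X + t₀ + y q + t₀)⁻¹ ^ 11 / 6 : ℝ)) : ℂ) := by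
  subst hm hS
  obtain ⟨hint, hcont⟩ := hbl_zeroModeDensity_integrable hθ hy hN ht₀
  have hmeas : Measurable D := hD ▸ hcont.measurable_piecewise continuousOn_const measurableSet_Ioi
  have hD' : ∀ l : ℝ, 0 < l → D l = (∑' q, θ q * Complex.exp (-(((y q + t₀) * l : ℝ) : ℂ))) *
      (((l ^ 4 / (3 * Real.Gamma 5) - l ^ 10 / (6 * Real.Gamma 11) : ℝ)) : ℂ) :=
    fun l hl => hD ▸ Set.piecewise_eq_of_mem _ _ _ hl
  have hint' : IntegrableOn D (Ioi 0) := hint.congr_fun (fun l hl => (hD' l hl).symm) measurableSet_Ioi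
  refine ⟨isFiniteMeasure_withDensity (ne_of_lt hint'.2), ?_, ?_, fun l => ?_, fun X hX => ?_⟩
  · refine withDensity_absolutelyContinuous _ _ ?_
    rw [Measure.restrict_apply measurableSet_Iio]
    exact measure_mono_null (fun x hx => (lt_irrefl (0 : ℝ) (hx.2.trans hx.1)).elim) measure_empty
  · exact (continuous_const.mul (Complex.continuous_exp.comp (Complex.continuous_ofReal.comp
      ((continuous_id.max continuous_const).mul continuous_const)).neg)).measurable.mul
      (hmeas.div (Complex.measurable_ofReal.comp hmeas.norm))
  · dsimp only
    rw [norm_mul, norm_mul, ← Complex.ofReal_neg, Complex.norm_exp_ofReal, norm_div,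
      Complex.norm_real, norm_norm]
    exact (mul_le_mul (mul_le_of_le_one_right (norm_nonneg _) (Real.exp_le_one_iff.2
      (neg_nonpos.2 (mul_nonneg (le_max_right _ _) ht₀.le)))) (div_self_le_one _)
      (div_nonneg (norm_nonneg _) (norm_nonneg _)) (norm_nonneg _)).trans_eq (mul_one _)
  · have hX' : 0 < X + t₀ := by linarith
    rw [integral_withDensity_eq_integral_toReal_smul hmeas.enorm
        (Eventually.of_forall fun _ => enorm_lt_top),
      (hbl_hasSum_zeroMode_eq_laplace hθ hy hN ht₀ hX').tsum_eq, ← integral_const_mul]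
    refine setIntegral_congr_fun measurableSet_Ioi fun l (hl : (0 : ℝ) < l) => ?_
    simp only [toReal_enorm]
    rw [← hD' l hl, max_eq_left hl.le, Complex.real_smul,
      show Complex.exp (-(((l * (X + t₀)) : ℝ) : ℂ)) =
        Complex.exp (-((l * X : ℝ) : ℂ)) * Complex.exp (-((l * t₀ : ℝ) : ℂ)) by
          rw [← Complex.exp_add]; congr 1; push_cast; ring]
    rcases eq_or_ne (D l) 0 with h0 | hz
    · simp [h0]
    · field_simp [Complex.ofReal_ne_zero.2 (norm_ne_zero_iff.2 hz)]

/-- Summability weights of the Bessel spokes: for `r ≥ 1`,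
`a rⁿ (∑_q e^{-2π r y_q}) · mass(besselLaplaceMeasure ν p (2πr) t₀) ≤ D e^{-π t₀ r}` (mass formula,
`integral_exp_sub_mul_cosh_le_exp_mul` with `c₀ = 2π`, `rⁿ ≤ n! (π t₀)⁻ⁿ e^{π t₀ r}`). [folklore] -/
private theorem hbl_mf_term_le (hy : ∀ q, 0 ≤ y q)
    (hN : ∀ j : ℕ, {q : R | (j : ℝ) ≤ y q ∧ y q ≤ j + 1}.encard ≤ N) (ν : ℝ) {p t₀ : ℝ}
    (hp : 0 < p) (ht₀ : 0 < t₀) (n : ℕ) {a : ℝ} (ha : 0 ≤ a) :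
    ∃ D : ℝ, ∀ r : ℝ, 1 ≤ r →
      a * r ^ n * (∑' q, Real.exp (-(2 * Real.pi * r * y q))) *
          (besselLaplaceMeasure ν p (2 * Real.pi * r) t₀).real univ ≤
        D * Real.exp (-(Real.pi * t₀ * r)) := by
  have h2π : 0 < 2 * Real.pi := by positivity
  have hY : ∀ {c : ℝ}, 0 < c → Summable fun q => Real.exp (-(c * y q)) := fun hc => by
    simpa only [norm_one, one_mul] using
      (hbl_shellSeries_summable (θ := fun _ : R => (1 : ℂ)) (fun _ => norm_one.le) hy hN hc).1
  exact ⟨_, fun r hr => by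
    have hc : 2 * Real.pi ≤ 2 * Real.pi * r := le_mul_of_one_le_right h2π.le hr
    have hr0 : 0 ≤ r := zero_le_one.trans hr
    have hpoly : r ^ n * Real.exp (-(Real.pi * t₀ * r)) ≤ n.factorial / (Real.pi * t₀) ^ n := by
      have h := Real.pow_div_factorial_le_exp _ (by positivity : 0 ≤ Real.pi * t₀ * r) n
      rw [mul_pow, div_le_iff₀ (by positivity)] at h
      rw [Real.exp_neg, mul_inv_le_iff₀ (Real.exp_pos _), div_mul_eq_mul_div,
        le_div_iff₀ (by positivity)]
      linarith
    calc a * r ^ n * (∑' q, Real.exp (-(2 * Real.pi * r * y q))) *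
          (besselLaplaceMeasure ν p (2 * Real.pi * r) t₀).real univ
        ≤ a * r ^ n * (∑' q, Real.exp (-(2 * Real.pi * y q))) *
            (t₀ ^ (-p) * (Real.exp (-((2 * Real.pi * r - 2 * Real.pi) * t₀)) *
              ∫ u, Real.exp (ν * u - 2 * Real.pi * t₀ * Real.cosh u))) := by
          gcongr a * r ^ n * ?_ * ?_
          · exact (hY (h2π.trans_le hc)).tsum_le_tsum (fun q => Real.exp_le_exp.2 (neg_le_neg
              (mul_le_mul_of_nonneg_right hc (hy q)))) (hY h2π)
          · rw [besselLaplaceMeasure_real_univ ν hp (h2π.trans_le hc) ht₀]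
            exact mul_le_mul_of_nonneg_left (integral_exp_sub_mul_cosh_le_exp_mul ν h2π hc ht₀)
              (Real.rpow_nonneg ht₀.le _)
      _ = a * (∑' q, Real.exp (-(2 * Real.pi * y q))) * t₀ ^ (-p) * Real.exp (2 * Real.pi * t₀) *
            (∫ u, Real.exp (ν * u - 2 * Real.pi * t₀ * Real.cosh u)) *
            (r ^ n * Real.exp (-(Real.pi * t₀ * r))) * Real.exp (-(Real.pi * t₀ * r)) := by
          rw [show -((2 * Real.pi * r - 2 * Real.pi) * t₀) =
            2 * Real.pi * t₀ + -(Real.pi * t₀ * r) + -(Real.pi * t₀ * r) by ring,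
            Real.exp_add, Real.exp_add]
          ring
      _ ≤ a * (∑' q, Real.exp (-(2 * Real.pi * y q))) * t₀ ^ (-p) * Real.exp (2 * Real.pi * t₀) *
            (∫ u, Real.exp (ν * u - 2 * Real.pi * t₀ * Real.cosh u)) *
            (n.factorial / (Real.pi * t₀) ^ n) * Real.exp (-(Real.pi * t₀ * r)) := by
          gcongr⟩

end Spokes

open Literature.Analysis.Complex in
/-- **From mode moments along an arithmetic progression to vanishing fibres** (binder form; `K` in
any universe, `R : Type`). See the module docstring; the profile `𝔪` is written inline. The sign
hypothesis on `θ k₀` is part of the registered interface and is not used here. [folklore] -/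
theorem hbl_fibres_eq_zero_of_modeMoments' {K : Type*} {R : Type} [Countable K] [Countable R]
    [DecidableEq K] (k₀ : K) (ρ : K → ℝ) (hρ0 : ρ k₀ = 0) (hρ : ∀ k, k ≠ k₀ → 0 < ρ k)
    (hfin : ∀ C : ℝ, {k : K | ρ k ≤ C}.Finite)
    (hexp : ∀ ε : ℝ, 0 < ε → Summable fun k : K => Real.exp (-(ε * ρ k)))
    (χ ψ : K → ℂ) (hχ : ∀ k, ‖χ k‖ = 1) (hψ : ∀ k, ‖ψ k‖ = 1) (hinj : Function.Injective χ)
    (θ : K → R → ℂ) (hθ : ∀ k q, ‖θ k q‖ ≤ 1) (_hθ0 : ∀ q, θ k₀ q = 1 ∨ θ k₀ q = -1)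
    (y : R → ℝ) (hy : ∀ q, 0 ≤ y q) {N : ℕ}
    (hN : ∀ j : ℕ, {q : R | (j : ℝ) ≤ y q ∧ y q ≤ j + 1}.encard ≤ N)
    {h X₀ : ℝ} (hh : 0 < h) (hX₀ : 0 < X₀)
    (hmom : ∀ n : ℕ, HasSum (fun k : K => ψ k * χ k ^ n *
      ∑' q : R, θ k q *
        (if k = k₀ then
          ((-(Real.pi * ((X₀ + n * h + y q)⁻¹ ^ 5 / 3 - (X₀ + n * h + y q)⁻¹ ^ 11 / 6)) : ℝ) : ℂ)
        else
          ((-(Real.pi / 6 * (Real.pi * ρ k) ^ 3) *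
              (((X₀ + n * h + y q) ^ (-(2 : ℝ)) : ℝ) *
                ∫ u : ℝ, Real.exp (3 * u - 2 * Real.pi * ρ k * (X₀ + n * h + y q) * Real.cosh u)) +
            (Real.pi / 720 * (Real.pi * ρ k) ^ 6) *
              (((X₀ + n * h + y q) ^ (-(5 : ℝ)) : ℝ) *
                ∫ u : ℝ, Real.exp (6 * u - 2 * Real.pi * ρ k * (X₀ + n * h + y q) * Real.cosh u)) :
            ℝ) : ℂ))) 0) :
    ∀ (k : K) (η : ℝ),
      ∑ q ∈ (hbl_shell_heights_finite hN hy η).toFinset with y q = η, θ k q = 0 := by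
  have ht₀ : 0 < X₀ / 2 := by positivity
  have hA : 0 ≤ X₀ - X₀ / 2 := by linarith
  have hρnn : ∀ k, 0 ≤ ρ k := fun k =>
    (eq_or_ne k k₀).elim (fun hk => by rw [hk, hρ0]) fun hk => (hρ k hk).le
  have hcpos : ∀ k, k ≠ k₀ → 0 < 2 * Real.pi * ρ k := fun k hk => by
    have := hρ k hk; positivity
  have hψ0 : ∀ k, ψ k ≠ 0 := fun k h0 => by have := hψ k; rw [h0, norm_zero] at this; norm_num at this
  -- the hedgehog data on `J = K × Bool`
  set cJ : K × Bool → ℝ := fun j => 2 * Real.pi * ρ j.1 with hcJ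
  set wt : K → Bool → ℂ := fun k b => ψ k *
    bif b then ((-(Real.pi / 6 * (Real.pi * ρ k) ^ 3) : ℝ) : ℂ)
      else ((Real.pi / 720 * (Real.pi * ρ k) ^ 6 : ℝ) : ℂ) with hwt
  set D₀ : ℝ → ℂ := (Ioi (0 : ℝ)).piecewise (fun l =>
    (∑' q, θ k₀ q * Complex.exp (-(((y q + X₀ / 2) * l : ℝ) : ℂ))) *
      (((l ^ 4 / (3 * Real.Gamma 5) - l ^ 10 / (6 * Real.Gamma 11) : ℝ)) : ℂ)) 0 with hD₀
  set m : K × Bool → Measure ℝ := fun j =>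
    if j.1 = k₀ then bif j.2 then (volume.restrict (Ioi (0 : ℝ))).withDensity fun l => ‖D₀ l‖ₑ else 0
    else bif j.2 then besselLaplaceMeasure 3 2 (2 * Real.pi * ρ j.1) (X₀ / 2)
      else besselLaplaceMeasure 6 5 (2 * Real.pi * ρ j.1) (X₀ / 2) with hm_def
  set S : K × Bool → ℝ → ℂ := fun j =>
    if j.1 = k₀ then bif j.2 then fun l => -(Real.pi : ℂ) * ψ k₀ *
      Complex.exp (-((max l 0 * (X₀ / 2) : ℝ) : ℂ)) * (D₀ l / (‖D₀ l‖ : ℂ)) else 0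
    else fun l => wt j.1 j.2 * Complex.exp (-((max l (2 * Real.pi * ρ j.1) * (X₀ - X₀ / 2) : ℝ) : ℂ)) *
      ∑' q, θ j.1 q * Complex.exp (-((y q : ℂ) * ((max l (2 * Real.pi * ρ j.1) : ℝ) : ℂ))) with hS_def
  set B : K × Bool → ℝ := fun j =>
    if j.1 = k₀ then ‖-(Real.pi : ℂ) * ψ k₀‖
    else ‖wt j.1 j.2‖ * ∑' q, Real.exp (-(2 * Real.pi * ρ j.1 * y q)) with hB_def
  have hzm := hbl_mf_zeroSpoke (hθ k₀) hy hN ht₀ (-(Real.pi : ℂ) * ψ k₀) hD₀ rfl rfl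
  have hdata : ∀ j, IsFiniteMeasure (m j) ∧ m j (Iio (cJ j)) = 0 ∧ Measurable (S j) ∧
      ∀ l, ‖S j l‖ ≤ B j := by
    rintro ⟨k, b⟩
    by_cases hk : k = k₀
    · rw [hk]
      cases b
      · simp only [hm_def, hS_def, hB_def, hcJ, if_true, cond_false]
        exact ⟨inferInstance, by simp, measurable_const, fun l => by simp⟩
      · simp only [hm_def, hS_def, hB_def, hcJ, if_true, cond_true, hρ0, mul_zero]
        exact ⟨hzm.1, hzm.2.1, hzm.2.2.1, hzm.2.2.2.1⟩
    · have hc := hcpos k hk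
      have hb := fun w => hbl_mf_besselSpoke (hθ k) hy hN hc hA w rfl
      cases b <;> simp only [hm_def, hS_def, hB_def, hcJ, hk, if_false, cond_true, cond_false]
      · exact ⟨isFiniteMeasure_besselLaplaceMeasure 6 (by norm_num) hc ht₀,
          besselLaplaceMeasure_Iio 6 (by norm_num) hc ht₀, (hb _).1, (hb _).2.1⟩
      · exact ⟨isFiniteMeasure_besselLaplaceMeasure 3 two_pos hc ht₀,
          besselLaplaceMeasure_Iio 3 two_pos hc ht₀, (hb _).1, (hb _).2.1⟩
  haveI : ∀ j, IsFiniteMeasure (m j) := fun j => (hdata j).1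
  have hm : ∀ j, m j (Iio (cJ j)) = 0 := fun j => (hdata j).2.1
  have hS : ∀ j, Measurable (S j) := fun j => (hdata j).2.2.1
  have hB : ∀ j l, ‖S j l‖ ≤ B j := fun j => (hdata j).2.2.2
  have hc0 : ∀ j, 0 ≤ cJ j := fun j => mul_nonneg (by positivity) (hρnn j.1)
  have hcfin : ∀ C : ℝ, {j : K × Bool | cJ j ≤ C}.Finite := fun C =>
    ((hfin (C / (2 * Real.pi))).prod (finite_univ (α := Bool))).subset fun j hj =>
      ⟨show ρ j.1 ≤ C / (2 * Real.pi) from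
        (le_div_iff₀ (by positivity)).2 (by have hj' : 2 * Real.pi * ρ j.1 ≤ C := hj; linarith),
        mem_univ _⟩
  -- summability of the weights
  have hB0 : ∀ j, 0 ≤ B j := fun j => by simp only [hB_def]; positivity
  have hsum : Summable fun j => B j * (m j).real univ := by
    refine (summable_prod_of_nonneg fun j => mul_nonneg (hB0 j) measureReal_nonneg).2
      ⟨fun k => (hasSum_fintype _).summable, ?_⟩
    obtain ⟨D₁, hD₁⟩ := hbl_mf_term_le hy hN 3 two_pos ht₀ 3
      (a := Real.pi / 6 * Real.pi ^ 3) (by positivity)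
    obtain ⟨D₂, hD₂⟩ := hbl_mf_term_le hy hN 6 (by norm_num : (0 : ℝ) < 5) ht₀ 6
      (a := Real.pi / 720 * Real.pi ^ 6) (by positivity)
    refine Summable.of_norm_bounded_eventually
      ((hexp _ (by positivity : 0 < Real.pi * (X₀ / 2))).mul_left (D₂ + D₁)) ?_
    filter_upwards [(hfin 1).compl_mem_cofinite] with k hk
    have hk1 : 1 < ρ k := not_le.1 hk
    have hk0 : k ≠ k₀ := by rintro rfl; rw [hρ0] at hk1; linarith
    rw [Real.norm_of_nonneg (tsum_nonneg fun b => mul_nonneg (hB0 _) measureReal_nonneg),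
      tsum_bool, add_mul]
    simp only [hm_def, hB_def, hwt, hk0, if_false, cond_true, cond_false]
    refine add_le_add ?_ ?_
    · rw [norm_mul, hψ, one_mul, Complex.norm_real, Real.norm_of_nonneg (by positivity),
        show Real.pi / 720 * (Real.pi * ρ k) ^ 6 = Real.pi / 720 * Real.pi ^ 6 * ρ k ^ 6 by ring]
      exact hD₂ (ρ k) hk1.le
    · rw [norm_mul, hψ, one_mul, Complex.norm_real, Real.norm_eq_abs, abs_neg,
        abs_of_nonneg (by positivity),
        show Real.pi / 6 * (Real.pi * ρ k) ^ 3 = Real.pi / 6 * Real.pi ^ 3 * ρ k ^ 3 by ring]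
      exact hD₁ (ρ k) hk1.le
  -- the Laplace transforms of the spokes
  have hLap : ∀ k, k ≠ k₀ → ∀ (b : Bool) (X Z : ℝ), Z = X + (X₀ - X₀ / 2) →
      ∫ l, Complex.exp (-((l * X : ℝ) : ℂ)) * S (k, b) l ∂(m (k, b)) =
        wt k b * ∫ l, Complex.exp (-((l * Z : ℝ) : ℂ)) *
          (∑' q, θ k q * Complex.exp (-((y q : ℂ) * ((max l (2 * Real.pi * ρ k) : ℝ) : ℂ))))
            ∂(m (k, b)) := by
    intro k hk b X Z hZ
    simp only [hS_def, hk, if_false]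
    exact (hbl_mf_besselSpoke (hθ k) hy hN (hcpos k hk) hA _ rfl).2.2 _ (hm (k, b)) X Z hZ
  have hfreq0 : ∀ X : ℝ, 0 ≤ X →
      (∫ l, Complex.exp (-((l * X : ℝ) : ℂ)) * S (k₀, true) l ∂(m (k₀, true))) +
        ∫ l, Complex.exp (-((l * X : ℝ) : ℂ)) * S (k₀, false) l ∂(m (k₀, false)) =
      -(Real.pi : ℂ) * ψ k₀ * ∑' q, θ k₀ q *
        ((((X + y q + X₀)⁻¹ ^ 5 / 3 - (X + y q + X₀)⁻¹ ^ 11 / 6 : ℝ)) : ℂ) := by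
    intro X hX
    simp only [hm_def, hS_def, if_true, cond_true, cond_false, integral_zero_measure, add_zero]
    rw [hzm.2.2.2.2 X hX]
    congr 1
    exact tsum_congr fun q => by rw [show X + X₀ / 2 + y q + X₀ / 2 = X + y q + X₀ by ring]
  have hmomJ : ∀ n : ℕ, HasSum (fun j : K × Bool => χ j.1 ^ n *
      ∫ l, Complex.exp (-((l * (n * h) : ℝ) : ℂ)) * S j l ∂(m j)) 0 := by
    intro n
    have hFs : Summable fun j : K × Bool => χ j.1 ^ n *
        ∫ l, Complex.exp (-((l * (n * h) : ℝ) : ℂ)) * S j l ∂(m j) := by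
      refine .of_norm_bounded hsum fun j => ?_
      rw [norm_mul, norm_pow, hχ, one_pow, one_mul]
      refine norm_integral_le_of_norm_le_const ?_
      filter_upwards [measure_eq_zero_iff_ae_notMem.1 (hm j)] with l hl
      rw [norm_mul, ← Complex.ofReal_neg, Complex.norm_exp_ofReal]
      exact (mul_le_mul (Real.exp_le_one_iff.2 (neg_nonpos.2 (mul_nonneg ((hc0 j).trans
        (not_lt.1 hl)) (by positivity)))) (hB j l) (norm_nonneg _) zero_le_one).trans_eq
        (one_mul _)
    have H := hFs.hasSum.prod_fiberwise fun k => hasSum_fintype _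
    have H2 : HasSum (fun k => ∑ b : Bool, χ k ^ n *
        ∫ l, Complex.exp (-((l * (n * h) : ℝ) : ℂ)) * S (k, b) l ∂(m (k, b))) 0 := by
      refine (hmom n).congr_fun fun k => ?_
      rw [Fintype.sum_bool, ← mul_add]
      by_cases hk : k = k₀
      · rw [hk, hfreq0 _ (by positivity), show ∀ T : ℂ, χ k₀ ^ n * (-(Real.pi : ℂ) * ψ k₀ * T) =
          ψ k₀ * χ k₀ ^ n * (-(Real.pi : ℂ) * T) from fun T => by ring]
        simp only [if_true]; congr 1; rw [← tsum_mul_left]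
        exact tsum_congr fun q => by
          rw [show X₀ + n * h + y q = n * h + y q + X₀ by ring]; push_cast; ring
      · have hXt : X₀ / 2 < X₀ + n * h := by have := mul_nonneg n.cast_nonneg hh.le; linarith
        rw [hLap k hk true (n * h) (X₀ + n * h - X₀ / 2) (by ring),
          hLap k hk false (n * h) (X₀ + n * h - X₀ / 2) (by ring)]
        simp only [hm_def, hwt, hk, if_false, cond_true, cond_false]
        rw [← (((hbl_hasSum_shell_eq_laplace (hθ k) hy hN 3 two_pos (hcpos k hk) ht₀ hXt).mul_left
          _).add ((hbl_hasSum_shell_eq_laplace (hθ k) hy hN 6 (by norm_num : (0 : ℝ) < 5)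
          (hcpos k hk) ht₀ hXt).mul_left _)).tsum_eq, ← tsum_mul_left, ← tsum_mul_left]
        exact tsum_congr fun q => by push_cast; ring
    exact H.unique H2 ▸ hFs.hasSum
  -- the direction classes are single frequencies
  have hpair : ∀ (k : K) (X : ℝ), 0 < X →
      (∫ l, Complex.exp (-((l * X : ℝ) : ℂ)) * S (k, true) l ∂(m (k, true))) +
        ∫ l, Complex.exp (-((l * X : ℝ) : ℂ)) * S (k, false) l ∂(m (k, false)) = 0 := by
    intro k X hX
    have h0 := ((hasSum_subtype_iff_indicator (s := {j : K × Bool | χ j.1 = χ k})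
      (f := fun j : K × Bool => ∫ l, Complex.exp (-(l : ℂ) * X) * S j l ∂(m j))).1
      (laplace_class_eq_zero_of_hedgehog_moments (χ := fun j : K × Bool => χ j.1)
        (fun j => hχ j.1) hc0 hcfin hh hm hS hB hsum (n₀ := 0) (fun n _ => hmomJ n)
        (χ k) hX)).tsum_eq
    rw [tsum_eq_sum (s := ({(k, true), (k, false)} : Finset (K × Bool))) fun j hj => ?_,
      Finset.sum_pair (show ((k, true) : K × Bool) ≠ (k, false) by simp),
      indicator_of_mem (show ((k, true) : K × Bool) ∈ {j : K × Bool | χ j.1 = χ k} from rfl),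
      indicator_of_mem (show ((k, false) : K × Bool) ∈ {j : K × Bool | χ j.1 = χ k} from rfl)]
      at h0
    · simpa only [neg_mul, ← Complex.ofReal_mul] using h0
    · rw [indicator_of_notMem]
      intro hj'
      obtain ⟨k', b⟩ := j; obtain rfl : k' = k := hinj hj'
      exact hj (by cases b <;> simp)
  -- conclusion: peel each frequency
  intro k η
  by_cases hk : k = k₀
  · rw [hk]
    refine hbl_zeroMode_fibres_eq_zero (hθ k₀) hy hN hX₀ one_pos (fun X hX => ?_) η
    have h1 := hpair k₀ X (by linarith)
    rw [hfreq0 X (by linarith)] at h1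
    exact (mul_eq_zero.1 h1).resolve_left (mul_ne_zero (neg_ne_zero.2
      (Complex.ofReal_ne_zero.2 Real.pi_ne_zero)) (hψ0 k₀))
  · have hc := hcpos k hk
    refine hbl_shell_fibres_eq_zero_of_laplace_eq (hθ k) hy hN 3 6 two_pos
      (by norm_num : (0 : ℝ) < 5) hc ht₀
      (fun κ hκ => besselLaplaceMeasure_le_mul_near_endpoint 3 6 two_pos (by norm_num) hc ht₀ hκ)
      (α := ((Real.pi / 6 * (Real.pi * ρ k) ^ 3 : ℝ) : ℂ))
      (β := ((Real.pi / 720 * (Real.pi * ρ k) ^ 6 : ℝ) : ℂ))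
      (Complex.ofReal_ne_zero.2 (by have := hρ k hk; positivity)) (X₁ := X₀ + 1)
      (fun X hX => ?_) η
    have h1 := hpair k (X - X₀) (by linarith)
    rw [hLap k hk true (X - X₀) (X - X₀ / 2) (by ring),
      hLap k hk false (X - X₀) (X - X₀ / 2) (by ring)] at h1
    simp only [hm_def, hwt, hk, if_false, cond_true, cond_false] at h1
    refine mul_left_cancel₀ (hψ0 k) ?_
    push_cast at h1 ⊢
    linear_combination -h1

/-- **From mode moments along an arithmetic progression to vanishing fibres** (registered stub of
the line, stated verbatim as registered: `K R : Type`). [folklore] -/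
theorem hbl_fibres_eq_zero_of_modeMoments : ∀ {K R : Type} [Countable K] [Countable R] [DecidableEq K] (k₀ : K) (ρ : K → ℝ), ρ k₀ = 0 → (∀ k, k ≠ k₀ → 0 < ρ k) → (∀ C : ℝ, {k : K | ρ k ≤ C}.Finite) → (∀ ε : ℝ, 0 < ε → Summable fun k : K => Real.exp (-(ε * ρ k))) → ∀ (χ ψ : K → ℂ), (∀ k, ‖χ k‖ = 1) → (∀ k, ‖ψ k‖ = 1) → Function.Injective χ → ∀ (θ : K → R → ℂ), (∀ k q, ‖θ k q‖ ≤ 1) → (∀ q, θ k₀ q = 1 ∨ θ k₀ q = -1) → ∀ (y : R → ℝ) (hy : ∀ q, 0 ≤ y q) {N : ℕ} (hN : ∀ j : ℕ, {q : R | (j : ℝ) ≤ y q ∧ y q ≤ j + 1}.encard ≤ N) {h X₀ : ℝ}, 0 < h → 0 < X₀ → (∀ n : ℕ, HasSum (fun k : K => ψ k * χ k ^ n * ∑' q : R, θ k q * (if k = k₀ then ((-(Real.pi * ((X₀ + n * h + y q)⁻¹ ^ 5 / 3 - (X₀ + n * h + y q)⁻¹ ^ 11 / 6)) : ℝ) :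 ℂ) else ((-(Real.pi / 6 * (Real.pi * ρ k) ^ 3) * (((X₀ + n * h + y q) ^ (-(2 : ℝ)) : ℝ) * ∫ u : ℝ, Real.exp (3 * u - 2 * Real.pi * ρ k * (X₀ + n * h + y q) * Real.cosh u)) + (Real.pi / 720 * (Real.pi * ρ k) ^ 6) * (((X₀ + n * h + y q) ^ (-(5 : ℝ)) : ℝ) * ∫ u : ℝ, Real.exp (6 * u - 2 * Real.pi * ρ k * (X₀ + n * h + y q) * Real.cosh u)) : ℝ) : ℂ))) 0) → ∀ (k : K) (η : ℝ), ∑ q ∈ (Summit.AtomisticToContinuum.Crystallization.Theorems.HolmgrenBoyleLind.hbl_shell_heights_finite hN hy η).toFinset with y q = η, θ k q = 0 := by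
  intro K R _ _ _ k₀ ρ a b c d χ ψ e f g θ i j y hy N hN h X₀ hh hX hm
  exact hbl_fibres_eq_zero_of_modeMoments' k₀ ρ a b c d χ ψ e f g θ i j y hy hN hh hX hm

end Summit.AtomisticToContinuum.Crystallization.Theorems.HolmgrenBoyleLind

end
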